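import Mathlib.Analysis.Calculus.ContDiff.RCLike
import Mathlib.Analysis.Calculus.ContDiff.Comp
import Mathlib.Analysis.Calculus.MeanValue
import HarnessLib

/-!
# NE7RectangleSecondOrder — THE SECOND-ORDER RECTANGLE INEQUALITY OF A `C²` FUNCTION: for `f : E → ℝ` of class `C²` at `p₀` there are `K ≥ 0`, `r > 0` with
# `|f(p+u+v) − f(p+u) − f(p+v) + f(p)| ≤ K‖u‖‖v‖` whenever the four corners lie in `ball p₀ r` — the calculus letter of the «4-POINT SCHEME» by which gen 114 upgrades
# the Hölder-½ dependence of the constrained minimiser `U_k(V)` on the datum `V` (✓ p820556 `NE7MinimiserHoelderHalf`) to LIPSCHITZ dependence: the symmetric fibre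
# transport `[A(θ(0,z)) − A(θ(y,z))] + [A(θ(y,0)) − A(θ(0,0))]` through a `C²` straightening `θ` of the admissible fibration is a rectangle of `A ∘ chart ∘ θ`, hence
# `≤ K‖y‖‖z‖` — second order, where the one-sided transport of gen 113 (`chart_fibre_quantitative`) is only first order

Cell `pub-balaban`, rung (B)+1 sub-cell t4, lineage `b2b-balaban-t4-ne7-p1` (CRUX PROVER NE7 #1 = OWNER of BINDER row NE7), generation 114.  Memo
`t4/b2b-balaban-t4-ne7-p1-g114/ROAD-G114.md` §1.
THE ARGUMENT.  `fderiv f` is `C¹` at `p₀`, hence Lipschitz with some constant `K` on a neighbourhood `t` (Mathlib `ContDiffAt.exists_lipschitzOnWith`); `f` is differentiable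
near `p₀`; take a ball inside both.  For the rectangle put `h(x) := f(x+u) − f(x)` on the segment `[p, p+v]` (inside the ball by convexity, and so is its `u`-translate):
`h` has derivative `fderiv f (x+u) − fderiv f x` of norm `≤ K‖u‖`, so the mean value inequality on the convex segment (`Convex.norm_image_sub_le_of_norm_hasFDerivWithin_le`)
gives `|h(p+v) − h(p)| ≤ K‖u‖·‖v‖`.
WHAT ([folklore]; 0 def, 0 sorry; any real normed space `E`).  **`rectangle_bound_of_contDiffAt_two`** (statement in the docstring).
HONEST FRAMING (page 1): elementary calculus, nothing of Bałaban's; a letter for this lineage's datum-dependence line (ROAD-G113 §6 next (i)); NOT NE7, NOT NE3; spine 0∕9; finite T⁴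
rung (B)+1 — NOT infinite volume, NOT mass gap, NOT BetaPertH, NOT Clay (continuum YM on T⁴ ⇐ BetaPertH ∧ nine spine estimates).
-/

set_option autoImplicit false

open scoped Topology NNReal
open Set Filter Metric

namespace Summit.QuantumFields.BalabanUV.T4Continuum.NE7RectangleSecondOrder

variable {E : Type*} [NormedAddCommGroup E] [NormedSpace ℝ E]

/-- **THE SECOND-ORDER RECTANGLE INEQUALITY.**  If `f : E → ℝ` is `C²` at `p₀`, there are `K ≥ 0` and `r > 0` such that for all `p u v` with `p`, `p+u`, `p+v`, `p+u+v` in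
`ball p₀ r`: `|f (p+u+v) − f (p+u) − f (p+v) + f p| ≤ K·‖u‖·‖v‖`. [folklore] -/
theorem rectangle_bound_of_contDiffAt_two {f : E → ℝ} {p₀ : E} (hf : ContDiffAt ℝ 2 f p₀) :
    ∃ K r : ℝ, 0 ≤ K ∧ 0 < r ∧ ∀ p u v : E, p ∈ ball p₀ r → p + u ∈ ball p₀ r → p + v ∈ ball p₀ r → p + u + v ∈ ball p₀ r →
      |f (p + u + v) - f (p + u) - f (p + v) + f p| ≤ K * ‖u‖ * ‖v‖ := by
  -- `fderiv f` is `C¹`, hence Lipschitz near `p₀`; `f` is `C²` (so differentiable) near `p₀`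
  have hdf : ContDiffAt ℝ 1 (fderiv ℝ f) p₀ := ContDiffAt.fderiv_right hf (by norm_num)
  obtain ⟨K, t, ht, hLip⟩ := hdf.exists_lipschitzOnWith
  have hev : ∀ᶠ y in 𝓝 p₀, ContDiffAt ℝ 2 f y := hf.eventually (by simp)
  obtain ⟨r, hr, hball⟩ : ∃ r > 0, ball p₀ r ⊆ t ∩ {y | ContDiffAt ℝ 2 f y} := Metric.mem_nhds_iff.mp (inter_mem ht hev)
  refine ⟨K, r, K.2, hr, fun p u v hp hpu hpv hpuv => ?_⟩
  -- the segment `[p, p+v]` and its `u`-translate lie in the ball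
  have hseg : segment ℝ p (p + v) ⊆ ball p₀ r := (convex_ball p₀ r).segment_subset hp hpv
  have hsegu : ∀ x ∈ segment ℝ p (p + v), x + u ∈ ball p₀ r := by
    intro x hx
    have hx' : x + u ∈ segment ℝ (p + u) (p + v + u) := by
      obtain ⟨a, b, ha, hb, hab, rfl⟩ := hx
      refine ⟨a, b, ha, hb, hab, ?_⟩
      have e : a • (p + u) + b • (p + v + u) = (a • p + b • (p + v)) + (a + b) • u := by
        simp only [smul_add, add_smul]; abel
      rw [e, hab, one_smul]
    have h2 : segment ℝ (p + u) (p + v + u) ⊆ ball p₀ r :=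
      (convex_ball p₀ r).segment_subset hpu (by rwa [add_right_comm] at hpuv)
    exact h2 hx'
  -- the auxiliary function `h(x) = f(x+u) − f(x)` and its derivative on the segment
  have hderiv : ∀ x ∈ segment ℝ p (p + v),
      HasFDerivWithinAt (fun x => f (x + u) - f x) (fderiv ℝ f (x + u) - fderiv ℝ f x) (segment ℝ p (p + v)) x := by
    intro x hx
    have h1c : ContDiffAt ℝ 2 f (x + u) := (hball (hsegu x hx)).2
    have h2c : ContDiffAt ℝ 2 f x := (hball (hseg hx)).2
    have h1 : DifferentiableAt ℝ f (x + u) := ContDiffAt.differentiableAt h1c (by norm_num)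
    have h2 : DifferentiableAt ℝ f x := ContDiffAt.differentiableAt h2c (by norm_num)
    have h1' : HasFDerivAt (fun x => f (x + u)) (fderiv ℝ f (x + u)) x := by
      have hc := h1.hasFDerivAt.comp x ((hasFDerivAt_id x).add_const u)
      rw [ContinuousLinearMap.comp_id] at hc
      exact hc
    exact (h1'.sub h2.hasFDerivAt).hasFDerivWithinAt
  have hbound : ∀ x ∈ segment ℝ p (p + v), ‖fderiv ℝ f (x + u) - fderiv ℝ f x‖ ≤ K * ‖u‖ := by
    intro x hx
    have h := hLip.norm_sub_le (hball (hsegu x hx)).1 (hball (hseg hx)).1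
    simpa using h
  have hmvt := Convex.norm_image_sub_le_of_norm_hasFDerivWithin_le hderiv hbound (convex_segment p (p + v))
    (left_mem_segment ℝ p (p + v)) (right_mem_segment ℝ p (p + v))
  -- read off the rectangle
  have e1 : (f (p + v + u) - f (p + v)) - (f (p + u) - f p) = f (p + u + v) - f (p + u) - f (p + v) + f p := by
    rw [add_right_comm p v u]; ring
  rw [Real.norm_eq_abs, e1, add_sub_cancel_left] at hmvt
  calc |f (p + u + v) - f (p + u) - f (p + v) + f p| ≤ K * ‖u‖ * ‖v‖ := hmvt
    _ = K * ‖u‖ * ‖v‖ := rfl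

end Summit.QuantumFields.BalabanUV.T4Continuum.NE7RectangleSecondOrder
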